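import Mathlib
import Literature.AlgebraicGeometry.Resolution.PolygonChartTransport
import HarnessLib

/-!
# The polygon under the blowing up of a curve: translation by one unit to the left

Topic: `Literature/AlgebraicGeometry/Resolution`. Cossart–Jannsen–Saito, LNM 2270, Lemma 12.4
(4) / Cossart–Piltant 2008, Lemma 4.5 (1): for the blowing up along the regular curve
`C = V(y, u₁)` — permissible for the idealistic exponent `(J, μ)`, i.e. `J ⊆ (y, u₁)^μ` — at the
unique point `x′` of the blow-up possibly near to `x`, with parameters `(y′ = y/u₁, u₁, u₂)`, the
weak transform `J′ = (J R′ : u₁^μ)` has characteristic polygon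

  `Δ(J′; u₁, u₂; y′) = Δ(J; u₁, u₂; y) − (1, 0)`,  so `α′ = α − 1`, `β′ = β`

("`Δ(E′; u₁, u₂; z′)` is the translated image of `Δ(E; u₁, u₂; z)` by one unit to the left",
CoP1 p. 11). Abstract chart: `φ : R → R′`, `c′₁ = φ u₁`, `φ y = φ u₁ · y′`, `c′₂ = φ u₂`.
PROVED for the scaled invariants of `PolygonInvariants` (no facts):

* `curveExp`, `curvePullbackWeight = (W′₀ + W′₁, W′₁, W′₂)`, `map_weightedIdealW_le_curve`,
  `colon_le_weightedIdealW_of_le_curve` (containments descend to the weak transform);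
* `exists_unitRep_pPow` — unit representatives of elements of `(y, u₁)^μ` supported in
  `{e₀ + e₁ ≥ μ}` modulo a deep weighted ideal; `isInitialTerm_curveChart`, `curvePt_mem_pts`
  (initial terms go up, `curvePt μ e = (e₀, e₀ + e₁ − μ, e₂)`);
* laws: `alphaS_curve_add` (`αs′ + L = αs`), `betaS_curve_eq` (`βs′ = βs`),
  `epsS_le_epsS_curve`/`exists_pts_curve_zeta` (`εs′ = εs` when realised, `ζs′ + L ≤ ζs`).

## Sources

* V. Cossart, U. Jannsen, S. Saito, LNM 2270 (2020), Lemma 12.4, (12.5). [CossartJannsenSaito2020]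
* V. Cossart, O. Piltant, J. Algebra 320 (2008), Lemma 4.5 (1) and its proof, p. 11.
  [CossartPiltant2008]
-/

noncomputable section

open IsLocalRing MvPolynomial

namespace Literature.AlgebraicGeometry.Resolution

universe u

/-! ## Unit representatives inside `(y, u₁)^μ` -/

section PPow

variable {R : Type u} [CommRing R] [IsRegularLocalRing R] (c : Fin 3 → R)
  (hgen : Ideal.span {c 0, c 1, c 2} = maximalIdeal R) (hdim : ringKrullDim R = 3)

omit [IsRegularLocalRing R] in
/-- `(y, u₁)^μ ⊆ F^{(K,K,1)}_{Kμ}` for every `K`. [folklore] -/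
theorem span_pair_pow_le_weightedIdealW (μ K : ℕ) :
    Ideal.span {c 0, c 1} ^ μ ≤ weightedIdealW c ![K, K, 1] (K * μ) := by
  have h1 : Ideal.span {c 0, c 1} ≤ weightedIdealW c ![K, K, 1] K := by
    rw [Ideal.span_le]
    have key : ∀ i : Fin 3, i ≠ 2 → c i ∈ weightedIdealW c ![K, K, 1] K := by
      intro i hi
      have : c i = monom3 c (Finsupp.single i 1) := by
        fin_cases i <;> simp [monom3] at hi ⊢
      rw [this]
      refine monomial_mem_weightedIdealW c _ ?_
      rw [Finsupp.weight_apply, Finsupp.sum_single_index (by simp)]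
      fin_cases i <;> simp at hi ⊢
    rintro x hx
    rcases hx with rfl | hx
    · exact key 0 (by decide)
    · rw [Set.mem_singleton_iff.mp hx]; exact key 1 (by decide)
  induction μ with
  | zero => rw [pow_zero, mul_zero, weightedIdealW_zero, Ideal.one_eq_top]
  | succ n ih =>
    rw [pow_succ, Nat.mul_succ]
    exact (Ideal.mul_mono ih h1).trans (weightedIdealW_mul_le c _ _ _)

include hgen hdim in
/-- **Unit representatives in `(y, u₁)^μ`**: if all the memberships `f ∈ F^{(K,K,1)}_{Kμ}` hold
(e.g. `f ∈ (y, u₁)^μ`), then modulo `F^{(w)}_K`, for any positive `w` and any `K`, `f` is a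
polynomial `G(c)` with unit coefficients supported in `{e₀ + e₁ ≥ μ}` (the monomials of a unit
representative with `e₀ + e₁ < μ` have `e₂ ≥ K` and are moved into the remainder).
[cite: CossartJannsenSaito2020, Lemma 12.4 (1), (12.5)] -/
theorem exists_unitRep_pPow {w : Fin 3 → ℕ} (hw : ∀ i, 0 < w i) {f : R} {μ : ℕ}
    (hf : ∀ K, f ∈ weightedIdealW c ![K, K, 1] (K * μ)) (K : ℕ) :
    ∃ G : MvPolynomial (Fin 3) R, HasUnitCoeffs G ∧ (∀ m ∈ G.support, μ ≤ m 0 + m 1) ∧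
      f - eval c G ∈ weightedIdealW c w K := by
  classical
  have hgenr := span_range_eq_of_span_triple c hgen
  set M := K * μ + μ + K with hM
  obtain ⟨F, hFu, -, hFrem⟩ := exists_unitRep c hgenr f M
  have hKw : ∀ i, 0 < (![K + 1, K + 1, 1] : Fin 3 → ℕ) i := by
    intro i; fin_cases i <;> simp
  have hremK : f - eval c F ∈ weightedIdealW c ![K + 1, K + 1, 1] M :=
    pow_maximalIdeal_le_weightedIdealW c hgenr hKw M hFrem
  have hlev : (K + 1) * μ ≤ M := by
    rw [hM, Nat.add_mul, one_mul]; omega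
  have hall := (mem_weightedIdealW_iff_of_unitRep c hgen hdim hKw hFu hremK hlev).mp (hf (K + 1))
  -- keep the monomials with `e₀ + e₁ ≥ μ`
  set S := F.support.filter (fun m => μ ≤ m 0 + m 1) with hS
  set G : MvPolynomial (Fin 3) R := ∑ m ∈ S, monomial m (F.coeff m) with hG
  have hGcoeff : ∀ m, G.coeff m = if m ∈ S then F.coeff m else 0 := by
    intro m
    rw [hG, coeff_sum]
    simp_rw [coeff_monomial]
    rw [Finset.sum_ite_eq']
  have hGsupp : ∀ m ∈ G.support, m ∈ S := by
    intro m hm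
    rw [mem_support_iff, hGcoeff] at hm
    by_contra h; rw [if_neg h] at hm; exact hm rfl
  refine ⟨G, ?_, ?_, ?_⟩
  · intro m hm
    have hmS := hGsupp m hm
    rw [hGcoeff, if_pos hmS]
    exact hFu m (Finset.mem_filter.mp hmS).1
  · intro m hm
    exact (Finset.mem_filter.mp (hGsupp m hm)).2
  · -- `f - G(c) = (f - F(c)) + (F - G)(c)`, and `F - G` has monomials with `e₂ ≥ K + 1`
    have hdiff : eval c (F - G) ∈ weightedIdealW c w K := by
      refine eval_mem_weightedIdealW_of_forall_le c w fun m hm => ?_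
      rw [mem_support_iff, coeff_sub, hGcoeff] at hm
      have hmF : m ∈ F.support := by
        by_contra h
        rw [notMem_support_iff.mp h] at hm
        split_ifs at hm with h' <;> simp at hm
      have hmS : m ∉ S := by
        intro h; rw [if_pos h, sub_self] at hm; exact hm rfl
      have hlt : m 0 + m 1 < μ := by
        by_contra h
        exact hmS (Finset.mem_filter.mpr ⟨hmF, not_lt.mp h⟩)
      have hwm := hall m hmF
      have hwt : Finsupp.weight (![K + 1, K + 1, 1] : Fin 3 → ℕ) m =
          (K + 1) * (m 0 + m 1) + m 2 := by
        rw [Finsupp.weight_apply, Finsupp.sum_fintype _ _ (by simp)]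
        simp [Fin.sum_univ_three]; ring
      rw [hwt] at hwm
      have hm2 : K + 1 ≤ m 2 := by
        have : (K + 1) * (m 0 + m 1) + (K + 1) ≤ (K + 1) * μ := by
          rw [← Nat.mul_succ]; exact Nat.mul_le_mul_left _ hlt
        omega
      have hwm2 : m 2 * w 2 ≤ Finsupp.weight w m := by
        rw [Finsupp.weight_apply, Finsupp.sum_fintype _ _ (by simp)]
        simp [Fin.sum_univ_three]
      have hw2 : 1 ≤ w 2 := hw 2
      have : (K + 1) * 1 ≤ m 2 * w 2 := Nat.mul_le_mul hm2 hw2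
      omega
    have hrem : f - eval c F ∈ weightedIdealW c w K :=
      weightedIdealW_antitone c w (by omega) (pow_maximalIdeal_le_weightedIdealW c hgenr hw M hFrem)
    have : f - eval c G = (f - eval c F) + eval c (F - G) := by rw [map_sub]; ring
    rw [this]
    exact Ideal.add_mem _ hrem hdiff

end PPow

/-! ## The curve chart -/

section CurveChart

variable {R R' : Type u} [CommRing R] [CommRing R'] (φ : R →+* R') {c : Fin 3 → R}
  {c' : Fin 3 → R'} (h₁ : c' 1 = φ (c 1)) (h₀ : φ (c 0) = φ (c 1) * c' 0)
  (h₂ : c' 2 = φ (c 2)) (W' : Fin 3 → ℕ)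

/-- The pulled-back weight `(W′₀ + W′₁, W′₁, W′₂)` of the curve chart. [cite: CossartJannsenSaito2020, (12.5)] -/
def curvePullbackWeight (W' : Fin 3 → ℕ) : Fin 3 → ℕ := ![W' 0 + W' 1, W' 1, W' 2]

/-- The exponent map `(e₀, e₁, e₂) ↦ (e₀, e₀ + e₁, e₂)` of the curve chart. [cite: CossartJannsenSaito2020, (12.5)] -/
def curveExp (e : Fin 3 →₀ ℕ) : Fin 3 →₀ ℕ := Finsupp.equivFunOnFinite.symm ![e 0, e 0 + e 1, e 2]

/-- Component / bookkeeping lemma. [folklore] -/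
@[simp] theorem curveExp_apply_zero (e : Fin 3 →₀ ℕ) : curveExp e 0 = e 0 := rfl
/-- Component / bookkeeping lemma. [folklore] -/
@[simp] theorem curveExp_apply_one (e : Fin 3 →₀ ℕ) : curveExp e 1 = e 0 + e 1 := rfl
/-- Component / bookkeeping lemma. [folklore] -/
@[simp] theorem curveExp_apply_two (e : Fin 3 →₀ ℕ) : curveExp e 2 = e 2 := rfl

/-- `curveExp` is injective. [folklore] -/
theorem curveExp_injective : Function.Injective curveExp := by
  intro m m' h
  have h0 := congrArg (fun n : Fin 3 →₀ ℕ => n 0) h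
  have h1 := congrArg (fun n : Fin 3 →₀ ℕ => n 1) h
  have h2 := congrArg (fun n : Fin 3 →₀ ℕ => n 2) h
  simp only [curveExp_apply_zero, curveExp_apply_one, curveExp_apply_two] at h0 h1 h2
  ext i
  fin_cases i
  · exact h0
  · simp only [Fin.mk_one]; omega
  · exact h2

/-- The curve chart turns the pulled-back weight into `W′`. [folklore] -/
theorem weight_curveExp (e : Fin 3 →₀ ℕ) :
    Finsupp.weight W' (curveExp e) = Finsupp.weight (curvePullbackWeight W') e := by
  rw [Finsupp.weight_apply, Finsupp.weight_apply, Finsupp.sum_fintype _ _ (by simp),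
    Finsupp.sum_fintype _ _ (by simp)]
  simp only [Fin.sum_univ_three, curveExp_apply_zero, curveExp_apply_one, curveExp_apply_two,
    curvePullbackWeight, Matrix.cons_val_zero, Matrix.cons_val_one, Matrix.cons_val_two,
    Matrix.tail_cons, Matrix.head_cons, smul_eq_mul]
  ring

include h₁ h₀ h₂ in
/-- The curve chart on monomials: `φ(c^e) = c′^{curveExp e}`. [cite: CossartJannsenSaito2020, (12.5)] -/
theorem map_monom3_curveChart (e : Fin 3 →₀ ℕ) : φ (monom3 c e) = monom3 c' (curveExp e) := by
  simp only [monom3, map_mul, map_pow, h₀, curveExp_apply_zero, curveExp_apply_one,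
    curveExp_apply_two, h₁, h₂]
  ring

include h₁ h₀ h₂ in
/-- `φ(F^{(W)}_ρ) ⊆ F′^{(W′)}_ρ` for the pulled-back weight `W` of the curve chart. [cite: CossartJannsenSaito2020, Lemma 12.4] -/
theorem map_weightedIdealW_le_curve (ρ : ℕ) :
    (weightedIdealW c (curvePullbackWeight W') ρ).map φ ≤ weightedIdealW c' W' ρ := by
  rw [weightedIdealW, Ideal.map_span, Ideal.span_le]
  rintro _ ⟨_, ⟨e, he, rfl⟩, rfl⟩
  rw [SetLike.mem_coe, map_monom3_curveChart φ h₁ h₀ h₂]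
  exact monomial_mem_weightedIdealW c' W' (by rwa [weight_curveExp])

/-- The exponent of the weak transform: `(e₀, e₀ + e₁ − μ, e₂)`. [cite: CossartJannsenSaito2020, (12.5)] -/
def curvePt (μ : ℕ) (e : Fin 3 →₀ ℕ) : Fin 3 →₀ ℕ :=
  Finsupp.equivFunOnFinite.symm ![e 0, e 0 + e 1 - μ, e 2]

/-- Component / bookkeeping lemma. [folklore] -/
@[simp] theorem curvePt_apply_zero (μ : ℕ) (e : Fin 3 →₀ ℕ) : curvePt μ e 0 = e 0 := rfl
/-- Component / bookkeeping lemma. [folklore] -/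
@[simp] theorem curvePt_apply_one (μ : ℕ) (e : Fin 3 →₀ ℕ) : curvePt μ e 1 = e 0 + e 1 - μ := rfl
/-- Component / bookkeeping lemma. [folklore] -/
@[simp] theorem curvePt_apply_two (μ : ℕ) (e : Fin 3 →₀ ℕ) : curvePt μ e 2 = e 2 := rfl

/-- `curvePt μ e + μ ε₁ = curveExp e` when `e₀ + e₁ ≥ μ`. [folklore] -/
theorem curvePt_add_single {μ : ℕ} {e : Fin 3 →₀ ℕ} (he : μ ≤ e 0 + e 1) :
    curvePt μ e + Finsupp.single 1 μ = curveExp e := by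
  ext i
  fin_cases i
  · simp [curvePt_apply_zero]
  · simp only [Fin.mk_one, Finsupp.add_apply, curvePt_apply_one, Finsupp.single_eq_same,
      curveExp_apply_one]
    omega
  · simp [curvePt_apply_two]

/-- `curvePt μ` is injective on `{e₀ + e₁ ≥ μ}`. [folklore] -/
theorem curvePt_injOn {μ : ℕ} {e e' : Fin 3 →₀ ℕ} (he : μ ≤ e 0 + e 1) (he' : μ ≤ e' 0 + e' 1)
    (h : curvePt μ e = curvePt μ e') : e = e' := by
  have := congrArg (fun m => m + Finsupp.single 1 μ) h
  simp only [curvePt_add_single he, curvePt_add_single he'] at this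
  exact curveExp_injective this

/-- `⟨W′, curvePt μ e⟩ + μ W′₁ = ⟨W, e⟩`. [cite: CossartJannsenSaito2020, (12.5)] -/
theorem weight_curvePt_add {μ : ℕ} {e : Fin 3 →₀ ℕ} (he : μ ≤ e 0 + e 1) :
    Finsupp.weight W' (curvePt μ e) + μ * W' 1 = Finsupp.weight (curvePullbackWeight W') e := by
  rw [← weight_curveExp, ← curvePt_add_single he, map_add]
  congr 1
  rw [Finsupp.weight_apply, Finsupp.sum_single_index (by simp), smul_eq_mul]

/-- The `y`-degree is unchanged by `curvePt`. [folklore] -/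
theorem sfac_curvePt (μ : ℕ) (e : Fin 3 →₀ ℕ) : sfac μ (curvePt μ e) = sfac μ e := by
  simp [sfac]

/-- Ordinate unchanged: `spt₂ (curvePt μ e) = spt₂ e`. [cite: CossartPiltant2008, p. 11] -/
theorem spt₂_curvePt (μ : ℕ) (e : Fin 3 →₀ ℕ) : spt₂ μ (curvePt μ e) = spt₂ μ e := by
  rw [spt₂, spt₂, sfac_curvePt, curvePt_apply_two]

/-- Abscissa translated by one unit: `spt₁ (curvePt μ e) + L = spt₁ e`.
[cite: CossartJannsenSaito2020, Lemma 12.4 (4)] [cite: CossartPiltant2008, p. 11] -/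
theorem spt₁_curvePt_add {μ : ℕ} {e : Fin 3 →₀ ℕ} (he₀ : e 0 < μ) (he : μ ≤ e 0 + e 1) :
    spt₁ μ (curvePt μ e) + μ.factorial = spt₁ μ e := by
  rw [spt₁, spt₁, sfac_curvePt, curvePt_apply_one, ← sub_mul_sfac he₀, ← add_mul]
  congr 1
  omega

include h₀ in
/-- `φ((y, u₁)^μ) R′ ⊆ ((φ u₁)^μ)`: the exceptional divisor is principal in the chart. [cite: CossartJannsenSaito2020, Lemma 12.4 (1)] -/
theorem map_span_pair_pow_le (μ : ℕ) :
    (Ideal.span {c 0, c 1} ^ μ).map φ ≤ Ideal.span {φ (c 1) ^ μ} := by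
  rw [Ideal.map_pow, ← Ideal.span_singleton_pow]
  refine Ideal.pow_right_mono ?_ μ
  rw [Ideal.map_span, Ideal.span_le]
  rintro _ ⟨x, hx, rfl⟩
  rcases hx with rfl | hx
  · rw [SetLike.mem_coe, h₀]; exact Ideal.mul_mem_right _ _ (Ideal.subset_span rfl)
  · rw [Set.mem_singleton_iff.mp hx]; exact Ideal.subset_span rfl

include h₀ in
/-- Every `f ∈ (y, u₁)^μ` has `φ f = (φ u₁)^μ g`. [folklore] -/
theorem exists_eq_pow_mul_of_mem_pPow {μ : ℕ} {f : R} (hf : f ∈ Ideal.span {c 0, c 1} ^ μ) :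
    ∃ g : R', φ f = φ (c 1) ^ μ * g := by
  have := map_span_pair_pow_le φ h₀ μ (Ideal.mem_map_of_mem _ hf)
  obtain ⟨g, hg⟩ := Ideal.mem_span_singleton'.mp this
  exact ⟨g, by rw [← hg, mul_comm]⟩

section Descend

variable [IsRegularLocalRing R'] (hgen' : Ideal.span {c' 0, c' 1, c' 2} = maximalIdeal R')
  (hdim' : ringKrullDim R' = 3) (hW' : ∀ i, 0 < W' i)

include h₁ h₀ h₂ hgen' hdim' hW' in
/-- **Containments descend to the weak transform** (curve chart): `J ⊆ F^{(W)}_{ρ′ + μ W′₁}` for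
the pulled-back weight implies `(J R′ : (φ u₁)^μ) ⊆ F′^{(W′)}_{ρ′}`.
[cite: CossartJannsenSaito2020, Lemma 12.4 (4)] [cite: CossartPiltant2008, Lemma 4.5 (1)] -/
theorem colon_le_weightedIdealW_of_le_curve {J : Ideal R} {μ ρ' : ℕ}
    (hJ : J ≤ weightedIdealW c (curvePullbackWeight W') (ρ' + μ * W' 1)) :
    (J.map φ).colon {φ (c 1) ^ μ} ≤ weightedIdealW c' W' ρ' := by
  intro g hg
  rw [Submodule.mem_colon_singleton, smul_eq_mul, mul_comm] at hg
  have h1 : φ (c 1) ^ μ * g ∈ weightedIdealW c' W' (ρ' + μ * W' 1) :=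
    map_weightedIdealW_le_curve φ h₁ h₀ h₂ W' _ (Ideal.map_mono hJ hg)
  have hmon : φ (c 1) ^ μ = monom3 c' (Finsupp.single 1 μ) := by simp [monom3, h₁]
  have hwt : Finsupp.weight W' (Finsupp.single 1 μ) = μ * W' 1 := by
    rw [Finsupp.weight_apply, Finsupp.sum_single_index (by simp), smul_eq_mul]
  refine mem_weightedIdealW_of_monom3_mul_mem c' hgen' hdim' hW' (Finsupp.single 1 μ) ?_
  rwa [hwt, ← hmon]

include h₁ hgen' hdim' hW' in
/-- `(φ u₁)^μ` is a non-zero-divisor of `R′` (a parameter of a regular local ring). [folklore] -/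
theorem pow_map_mul_left_cancel {μ : ℕ} {a b : R'} (h : φ (c 1) ^ μ * a = φ (c 1) ^ μ * b) :
    a = b := by
  haveI : IsDomain R' := isDomain_of_isRegularLocalRing R'
  refine mul_left_cancel₀ (pow_ne_zero _ fun h0 => ?_) h
  have h1 : IsInitialTerm c' W' (c' 1) (Finsupp.single 1 1) := by
    refine ⟨monomial (Finsupp.single 1 1) 1, isWeightedHomogeneous_monomial _ _ _ rfl, ?_, ?_⟩
    · rw [coeff_monomial, if_pos rfl]; exact isUnit_one
    · rw [eval_monomial_eq_monom3, one_mul]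
      have : monom3 c' (Finsupp.single 1 1) = c' 1 := by simp [monom3]
      rw [this, sub_self]; exact Ideal.zero_mem _
  have := h1.not_mem_succ c' hgen' hdim' hW'
  rw [h₁, h0] at this
  exact this (Ideal.zero_mem _)

end Descend

section Up

variable [IsRegularLocalRing R] [IsRegularLocalRing R']
  (hgen : Ideal.span {c 0, c 1, c 2} = maximalIdeal R) (hdim : ringKrullDim R = 3)
  (hgen' : Ideal.span {c' 0, c' 1, c' 2} = maximalIdeal R') (hdim' : ringKrullDim R' = 3)
  (hW' : ∀ i, 0 < W' i)

include h₁ h₀ h₂ hgen hdim hgen' hdim' hW' in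
/-- **Initial terms go up** (curve chart): if `f ∈ (y, u₁)^μ` has the initial unit term `e` for
the pulled-back weight `W` and `φ f = (φ u₁)^μ g`, then `curvePt μ e` is a `W′`-initial unit
term of `g`. [cite: CossartJannsenSaito2020, Lemma 12.4 (4)] [cite: CossartPiltant2008, Lemma 4.5 (1)] -/
theorem isInitialTerm_curveChart {μ : ℕ} {f : R} (hfμ : f ∈ Ideal.span {c 0, c 1} ^ μ)
    {e : Fin 3 →₀ ℕ} (he : IsInitialTerm c (curvePullbackWeight W') f e) {g : R'}
    (hg : φ f = φ (c 1) ^ μ * g) : IsInitialTerm c' W' g (curvePt μ e) := by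
  classical
  have hW : ∀ i, 0 < curvePullbackWeight W' i := by
    intro i
    fin_cases i
    · change 0 < W' 0 + W' 1; have := hW' 0; omega
    · exact hW' 1
    · exact hW' 2
  -- a relative unit representative of `f` with monomials in `{e₀ + e₁ ≥ μ}`
  set K := Finsupp.weight (curvePullbackWeight W') e + μ * W' 1 + 1 with hK
  have hfK : ∀ K, f ∈ weightedIdealW c ![K, K, 1] (K * μ) := fun K =>
    span_pair_pow_le_weightedIdealW c μ K hfμ
  obtain ⟨F, hFu, hFsupp, hFrem⟩ := exists_unitRep_pPow c hgen hdim hW hfK K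
  obtain ⟨heF, hmin⟩ := (isInitialTerm_iff_of_unitRep c hgen hdim hW hFu hFrem (by omega)).mp he
  -- the transported representative
  set G : MvPolynomial (Fin 3) R' := ∑ m ∈ F.support, monomial (curvePt μ m) (φ (F.coeff m))
    with hG
  have hGcoeff : ∀ m ∈ F.support, G.coeff (curvePt μ m) = φ (F.coeff m) := by
    intro m hm
    rw [hG, coeff_sum, Finset.sum_eq_single m]
    · rw [coeff_monomial, if_pos rfl]
    · intro m' hm' hne
      rw [coeff_monomial, if_neg]
      exact fun h' => hne (curvePt_injOn (hFsupp m' hm') (hFsupp m hm) h')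
    · intro hm'; exact absurd hm hm'
  have hGsupp : ∀ n ∈ G.support, ∃ m ∈ F.support, n = curvePt μ m := by
    intro n hn
    rw [hG] at hn
    obtain ⟨m, hm, hmn⟩ := Finset.mem_biUnion.mp (support_sum hn)
    exact ⟨m, hm, Finset.mem_singleton.mp (support_monomial_subset hmn)⟩
  have hGu : HasUnitCoeffs G := by
    intro n hn
    obtain ⟨m, hm, rfl⟩ := hGsupp n hn
    rw [hGcoeff m hm]
    exact (hFu m hm).map φ
  have hGeval : φ (c 1) ^ μ * eval c' G = φ (eval c F) := by
    conv_rhs => rw [F.as_sum, map_sum, map_sum]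
    rw [hG, map_sum, Finset.mul_sum]
    refine Finset.sum_congr rfl fun m hm => ?_
    rw [eval_monomial_eq_monom3, eval_monomial_eq_monom3, map_mul, map_monom3_curveChart φ h₁ h₀ h₂,
      ← curvePt_add_single (hFsupp m hm), monom3_add]
    have : monom3 c' (Finsupp.single 1 μ) = φ (c 1) ^ μ := by simp [monom3, h₁]
    rw [this]; ring
  -- `g - G(c′) ∈ F′_{K − μ W′₁}` by division
  have hdiff : g - eval c' G ∈ weightedIdealW c' W' (K - μ * W' 1) := by
    have hmem : φ (c 1) ^ μ * (g - eval c' G) ∈ weightedIdealW c' W' K := by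
      rw [mul_sub, ← hg, hGeval, ← map_sub]
      exact map_weightedIdealW_le_curve φ h₁ h₀ h₂ W' K (Ideal.mem_map_of_mem _ hFrem)
    have hmon : φ (c 1) ^ μ = monom3 c' (Finsupp.single 1 μ) := by simp [monom3, h₁]
    have hwt : Finsupp.weight W' (Finsupp.single 1 μ) = μ * W' 1 := by
      rw [Finsupp.weight_apply, Finsupp.sum_single_index (by simp), smul_eq_mul]
    refine mem_weightedIdealW_of_monom3_mul_mem c' hgen' hdim' hW' (Finsupp.single 1 μ) ?_
    rw [hwt, ← hmon, Nat.sub_add_cancel (by omega)]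
    exact hmem
  have hwt : Finsupp.weight W' (curvePt μ e) + μ * W' 1 =
      Finsupp.weight (curvePullbackWeight W') e := weight_curvePt_add W' (hFsupp e heF)
  refine (isInitialTerm_iff_of_unitRep c' hgen' hdim' hW' hGu hdiff (by omega)).mpr ⟨?_, ?_⟩
  · rw [mem_support_iff, hGcoeff e heF]
    exact ((hFu e heF).map φ).ne_zero
  · intro n hn
    obtain ⟨m, hm, rfl⟩ := hGsupp n hn
    have h1 := hmin m hm
    have h2 := weight_curvePt_add W' (hFsupp m hm)
    omega

include h₁ h₀ h₂ hgen hdim hgen' hdim' hW' in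
/-- **Newton points go up** (curve chart): if `e ∈ pts c J μ` is an initial unit term of some
`f ∈ J ⊆ (y, u₁)^μ` for the pull-back of the positive weight `W′`, then
`curvePt μ e ∈ pts c′ J′ μ`, `J′ = (J R′ : (φ u₁)^μ)`. [cite: CossartJannsenSaito2020, Lemma 12.4 (4)] -/
theorem curvePt_mem_pts {J : Ideal R} {μ : ℕ} (hJμ : J ≤ Ideal.span {c 0, c 1} ^ μ) {f : R}
    (hf : f ∈ J) {e : Fin 3 →₀ ℕ} (he₀ : e 0 < μ)
    (he : IsInitialTerm c (curvePullbackWeight W') f e) :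
    curvePt μ e ∈ pts c' ((J.map φ).colon {φ (c 1) ^ μ}) μ := by
  obtain ⟨g, hg⟩ := exists_eq_pow_mul_of_mem_pPow φ h₀ (hJμ hf)
  refine ⟨⟨g, ?_, W', hW', isInitialTerm_curveChart φ h₁ h₀ h₂ W' hgen hdim hgen' hdim' hW'
    (hJμ hf) he hg⟩, he₀⟩
  rw [Submodule.mem_colon_singleton, smul_eq_mul, mul_comm, ← hg]
  exact Ideal.mem_map_of_mem _ hf

end Up

end CurveChart

/-! ## The laws -/

section Laws

variable {R R' : Type u} [CommRing R] [CommRing R'] (φ : R →+* R') {c : Fin 3 → R}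
  {c' : Fin 3 → R'} (h₁ : c' 1 = φ (c 1)) (h₀ : φ (c 0) = φ (c 1) * c' 0)
  (h₂ : c' 2 = φ (c 2))
  [IsRegularLocalRing R] [IsRegularLocalRing R']
  (hgen : Ideal.span {c 0, c 1, c 2} = maximalIdeal R) (hdim : ringKrullDim R = 3)
  (hgen' : Ideal.span {c' 0, c' 1, c' 2} = maximalIdeal R') (hdim' : ringKrullDim R' = 3)
  {J : Ideal R} {μ : ℕ}

/-- The curve pull-back of a level weight: `(w₀′ + L p₁′, L p₁′, L p₂′)`. [folklore] -/
theorem levelWeight_eq_curvePullbackWeight (μ w₀' p₁' p₂' : ℕ) :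
    levelWeight μ (w₀' + μ.factorial * p₁') p₁' p₂' =
      curvePullbackWeight (levelWeight μ w₀' p₁' p₂') := by
  funext i; fin_cases i <;> rfl

local notation "J'" => Submodule.colon (Ideal.map φ J) ({φ (c 1) ^ μ} : Set R')

include h₁ h₀ h₂ hgen hdim hgen' hdim' in
/-- **Transport of half-planes** (curve chart): if all points of `pts c J μ` satisfy
`p₁′ (x₁ − L) + p₂′ x₂ ≥ w₀′` then all points of `pts c′ J′ μ` satisfy `p₁′ x₁ + p₂′ x₂ ≥ w₀′`
(`w₀′, p₁′, p₂′ > 0`). [cite: CossartJannsenSaito2020, Lemma 12.4 (4)] -/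
theorem forall_pts_colon_curve_of_forall_pts {w₀' p₁' p₂' : ℕ} (hw₀' : 0 < w₀') (hp₁' : 0 < p₁')
    (hp₂' : 0 < p₂')
    (hS : ∀ e ∈ pts c J μ, w₀' + μ.factorial * p₁' ≤ p₁' * spt₁ μ e + p₂' * spt₂ μ e) :
    ∀ e' ∈ pts c' J' μ, w₀' ≤ p₁' * spt₁ μ e' + p₂' * spt₂ μ e' := by
  have hJ : J ≤ weightedIdealW c (levelWeight μ (w₀' + μ.factorial * p₁') p₁' p₂')
      ((w₀' + μ.factorial * p₁') * μ) :=
    (le_weightedIdealW_levelWeight_iff c hgen hdim J (by omega) hp₁' hp₂').mpr hS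
  rw [levelWeight_eq_curvePullbackWeight] at hJ
  have hlev : (w₀' + μ.factorial * p₁') * μ = w₀' * μ + μ * (levelWeight μ w₀' p₁' p₂' 1) := by
    rw [levelWeight_one]; ring
  rw [hlev] at hJ
  have hW' := levelWeight_pos (μ := μ) hw₀' hp₁' hp₂'
  have hJ' := colon_le_weightedIdealW_of_le_curve φ h₁ h₀ h₂ _ hgen' hdim' hW' hJ
  exact (le_weightedIdealW_levelWeight_iff c' hgen' hdim' _ hw₀' hp₁' hp₂').mp hJ'

/-- Positivity of `N (αs − L) + βs` when `L < δs ≤ αs + βs`, `L ≤ αs`, `N ≥ 1`. [folklore] -/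
theorem pos_of_deltaS {L a b d N : ℕ} (hδ : L < d) (hd : d ≤ a + b) (hα : L ≤ a) (hN : 1 ≤ N) :
    0 < N * (a - L) + b := by
  rcases hα.eq_or_lt with rfl | hlt
  · simp only [Nat.sub_self, mul_zero, zero_add]; omega
  · have : 1 ≤ a - L := by omega
    have : 1 * 1 ≤ N * (a - L) := Nat.mul_le_mul hN this
    omega

include h₁ h₀ h₂ hgen hdim hgen' hdim' in
/-- Lower bound `N x₁′ + x₂′ ≥ N (αs − L) + βs` for the points of the weak transform, for all
`N ≥ βs + 1` (`L < δs`, `L ≤ αs`). [cite: CossartJannsenSaito2020, Lemma 12.4 (4)] -/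
theorem lowerBound_pts_colon_curve (hne : (pts c J μ).Nonempty) (hδ : μ.factorial < deltaS c J μ)
    (hα : μ.factorial ≤ alphaS c J μ) {N : ℕ} (hN : betaS c J μ + 1 ≤ N) :
    ∀ e' ∈ pts c' J' μ, N * (alphaS c J μ - μ.factorial) + betaS c J μ ≤
      N * spt₁ μ e' + 1 * spt₂ μ e' := by
  have hpos := pos_of_deltaS hδ (deltaS_le_alphaS_add_betaS hne) hα (show 1 ≤ N by omega)
  refine forall_pts_colon_curve_of_forall_pts φ h₁ h₀ h₂ hgen hdim hgen' hdim' hpos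
    (by omega) Nat.one_pos fun e he => ?_
  have hkey : N * (alphaS c J μ - μ.factorial) + μ.factorial * N = N * alphaS c J μ := by
    rw [Nat.mul_sub, mul_comm (μ.factorial) N]
    exact Nat.sub_add_cancel (Nat.mul_le_mul_left _ hα)
  have hαe := alphaS_le he
  rcases hαe.eq_or_lt with heq | hlt
  · have hβe := betaS_le he heq.symm
    rw [← heq]; omega
  · have h1 : alphaS c J μ + 1 ≤ spt₁ μ e := hlt
    have h2 := Nat.mul_le_mul_left N h1
    rw [Nat.mul_add, mul_one] at h2
    omega

include h₁ h₀ h₂ hgen hdim hgen' hdim' in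
/-- Every point of the weak transform has `spt₁′ + L ≥ αs`. [cite: CossartJannsenSaito2020, Lemma 12.4 (4)] -/
theorem alphaS_le_spt₁_colon_curve_add (hne : (pts c J μ).Nonempty)
    (hδ : μ.factorial < deltaS c J μ) (hα : μ.factorial ≤ alphaS c J μ) {e' : Fin 3 →₀ ℕ}
    (he' : e' ∈ pts c' J' μ) : alphaS c J μ ≤ spt₁ μ e' + μ.factorial := by
  by_contra hlt
  push Not at hlt
  set N := betaS c J μ + spt₂ μ e' + 1 with hN
  have h := lowerBound_pts_colon_curve φ h₁ h₀ h₂ hgen hdim hgen' hdim' hne hδ hα (N := N)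
    (by omega) e' he'
  have h1 : spt₁ μ e' + 1 ≤ alphaS c J μ - μ.factorial := by omega
  have h2 : N * (spt₁ μ e' + 1) ≤ N * (alphaS c J μ - μ.factorial) := Nat.mul_le_mul_left _ h1
  rw [Nat.mul_add, mul_one] at h2
  omega

include h₁ h₀ h₂ hgen hdim hgen' hdim' in
/-- On the line `x₁′ = α − 1` the new ordinates are `≥ β`. [cite: CossartJannsenSaito2020, Lemma 12.4 (4)] -/
theorem betaS_le_spt₂_colon_curve (hne : (pts c J μ).Nonempty) (hδ : μ.factorial < deltaS c J μ)
    (hα : μ.factorial ≤ alphaS c J μ) {e' : Fin 3 →₀ ℕ} (he' : e' ∈ pts c' J' μ)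
    (h1 : spt₁ μ e' + μ.factorial = alphaS c J μ) : betaS c J μ ≤ spt₂ μ e' := by
  have h := lowerBound_pts_colon_curve φ h₁ h₀ h₂ hgen hdim hgen' hdim' hne hδ hα le_rfl e' he'
  have : spt₁ μ e' = alphaS c J μ - μ.factorial := by omega
  rw [this] at h
  omega

include h₁ h₀ h₂ hgen hdim hgen' hdim' in
/-- **Realisation of the vertex `v`** (curve chart): `v = (α, β)` goes up to `(α − 1, β)`
(`J ⊆ (y, u₁)^μ`, `L < δs`, `L ≤ αs`). [cite: CossartJannsenSaito2020, Lemma 12.4 (4)] -/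
theorem exists_pts_colon_curve_v (hJμ : J ≤ Ideal.span {c 0, c 1} ^ μ)
    (hne : (pts c J μ).Nonempty) (hδ : μ.factorial < deltaS c J μ)
    (hα : μ.factorial ≤ alphaS c J μ) :
    ∃ e' ∈ pts c' J' μ, spt₁ μ e' + μ.factorial = alphaS c J μ ∧ spt₂ μ e' = betaS c J μ := by
  obtain ⟨e, he, h1, h2⟩ := exists_pts_v hne
  set N := betaS c J μ + 1 with hN
  have hmin : ∀ x ∈ pts c J μ, N * spt₁ μ e + 1 * spt₂ μ e ≤ N * spt₁ μ x + 1 * spt₂ μ x := by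
    have key := isMinOn_lex (S := pts c J μ) (ℓ₁ := spt₁ μ) (ℓ₂ := spt₂ μ) (e := e)
      (fun x hx => by rw [h1]; exact alphaS_le hx)
      (fun x hx hx1 => by rw [h2]; exact betaS_le hx (by rw [hx1, h1]))
    intro x hx
    have := key x hx
    rw [h2] at this ⊢
    rw [hN]; omega
  have hℓ : N * spt₁ μ e + 1 * spt₂ μ e = N * alphaS c J μ + betaS c J μ := by
    rw [← h1, ← h2]; ring
  have hposv := pos_of_deltaS hδ (deltaS_le_alphaS_add_betaS hne) hα (show 1 ≤ N by omega)
  have hkey : N * (alphaS c J μ - μ.factorial) + μ.factorial * N = N * alphaS c J μ := by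
    rw [Nat.mul_sub, mul_comm (μ.factorial) N]
    exact Nat.sub_add_cancel (Nat.mul_le_mul_left _ hα)
  have hpos : 0 < N * spt₁ μ e + 1 * spt₂ μ e := by rw [hℓ]; omega
  obtain ⟨f, hf, hinit⟩ := exists_isInitialTerm_levelWeight_of_isMinOn c hgen hdim (by omega)
    Nat.one_pos he hmin hpos
  have hsub : μ.factorial * N ≤ N * spt₁ μ e + 1 * spt₂ μ e := by rw [hℓ]; omega
  set w₀' := N * spt₁ μ e + 1 * spt₂ μ e - μ.factorial * N with hw₀'
  have hwt : levelWeight μ (N * spt₁ μ e + 1 * spt₂ μ e) N 1 =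
      curvePullbackWeight (levelWeight μ w₀' N 1) := by
    rw [← levelWeight_eq_curvePullbackWeight, Nat.sub_add_cancel hsub]
  rw [hwt] at hinit
  have hW' : ∀ i, 0 < levelWeight μ w₀' N 1 i := by
    refine levelWeight_pos ?_ (by omega) Nat.one_pos
    rw [hw₀', hℓ]; omega
  refine ⟨curvePt μ e, curvePt_mem_pts φ h₁ h₀ h₂ _ hgen hdim hgen' hdim' hW' hJμ hf he.2 hinit,
    ?_, ?_⟩
  · have hdeg : μ ≤ e 0 + e 1 := by
      -- `spt₁ e = αs ≥ L`, i.e. `e₁ · sfac ≥ (μ − e₀) · sfac`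
      have h3 : (μ - e 0) * sfac μ e ≤ e 1 * sfac μ e := by
        rw [sub_mul_sfac he.2]; rw [← h1, spt₁] at hα; exact hα
      have := Nat.le_of_mul_le_mul_right h3 (sfac_pos he.2)
      omega
    have := spt₁_curvePt_add he.2 hdeg
    omega
  · rw [spt₂_curvePt, h2]

include h₁ h₀ h₂ hgen hdim hgen' hdim' in
/-- The weak transform has points of `y`-degree `< μ`. [folklore] -/
theorem pts_colon_curve_nonempty (hJμ : J ≤ Ideal.span {c 0, c 1} ^ μ)
    (hne : (pts c J μ).Nonempty) (hδ : μ.factorial < deltaS c J μ)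
    (hα : μ.factorial ≤ alphaS c J μ) : (pts c' J' μ).Nonempty := by
  obtain ⟨e', he', -⟩ := exists_pts_colon_curve_v φ h₁ h₀ h₂ hgen hdim hgen' hdim' hJμ hne hδ hα
  exact ⟨e', he'⟩

include h₁ h₀ h₂ hgen hdim hgen' hdim' in
/-- **CJS Lemma 12.4 (4) / CoP1 Lemma 4.5 (1): `α′ = α − 1`** (scaled: `αs′ + L = αs`).
[cite: CossartJannsenSaito2020, Lemma 12.4 (4)] [cite: CossartPiltant2008, Lemma 4.5 (1)] -/
theorem alphaS_colon_curve_add (hJμ : J ≤ Ideal.span {c 0, c 1} ^ μ)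
    (hne : (pts c J μ).Nonempty) (hδ : μ.factorial < deltaS c J μ)
    (hα : μ.factorial ≤ alphaS c J μ) : alphaS c' J' μ + μ.factorial = alphaS c J μ := by
  have hne' := pts_colon_curve_nonempty φ h₁ h₀ h₂ hgen hdim hgen' hdim' hJμ hne hδ hα
  obtain ⟨e', he', he1, -⟩ := exists_pts_colon_curve_v φ h₁ h₀ h₂ hgen hdim hgen' hdim' hJμ hne hδ hα
  refine le_antisymm ?_ ?_
  · have := alphaS_le he'; omega
  · obtain ⟨a, ha, ha1⟩ := exists_pts_alphaS hne'
    have := alphaS_le_spt₁_colon_curve_add φ h₁ h₀ h₂ hgen hdim hgen' hdim' hne hδ hα ha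
    omega

include h₁ h₀ h₂ hgen hdim hgen' hdim' in
/-- **CJS Lemma 12.4 (4) / CoP1 Lemma 4.5 (1): `β′ = β`.**
[cite: CossartJannsenSaito2020, Lemma 12.4 (4)] [cite: CossartPiltant2008, Lemma 4.5 (1)] -/
theorem betaS_colon_curve_eq (hJμ : J ≤ Ideal.span {c 0, c 1} ^ μ)
    (hne : (pts c J μ).Nonempty) (hδ : μ.factorial < deltaS c J μ)
    (hα : μ.factorial ≤ alphaS c J μ) : betaS c' J' μ = betaS c J μ := by
  have hαeq := alphaS_colon_curve_add φ h₁ h₀ h₂ hgen hdim hgen' hdim' hJμ hne hδ hα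
  obtain ⟨e', he', he1, he2⟩ := exists_pts_colon_curve_v φ h₁ h₀ h₂ hgen hdim hgen' hdim' hJμ hne hδ hα
  have hne' : (pts c' J' μ).Nonempty := ⟨e', he'⟩
  refine le_antisymm ?_ ?_
  · rw [← he2]; exact betaS_le he' (by omega)
  · obtain ⟨b, hb, hb1, hb2⟩ := exists_pts_v hne'
    rw [← hb2]
    exact betaS_le_spt₂_colon_curve φ h₁ h₀ h₂ hgen hdim hgen' hdim' hne hδ hα hb (by omega)

/-! ### The lowest vertex under the curve chart: `ε′ = ε`, `ζ′ = ζ − 1` -/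

include h₁ h₀ h₂ hgen hdim hgen' hdim' in
/-- **Realisation of `(ζ, ε)`** (curve chart): the lowest vertex goes up to `(ζ − 1, ε)`.
[cite: CossartJannsenSaito2020, Lemma 12.4 (4)] -/
theorem exists_pts_colon_curve_zeta (hJμ : J ≤ Ideal.span {c 0, c 1} ^ μ)
    (hne : (pts c J μ).Nonempty) (hδ : μ.factorial < deltaS c J μ)
    (hα : μ.factorial ≤ alphaS c J μ) :
    ∃ e' ∈ pts c' J' μ, spt₂ μ e' = epsS c J μ ∧ spt₁ μ e' + μ.factorial = zetaS c J μ := by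
  obtain ⟨e, he, h2, h1⟩ := exists_pts_zeta hne
  set N := zetaS c J μ + 2 with hN
  have hmin : ∀ x ∈ pts c J μ, 1 * spt₁ μ e + N * spt₂ μ e ≤ 1 * spt₁ μ x + N * spt₂ μ x := by
    have key := isMinOn_lex (S := pts c J μ) (ℓ₁ := spt₂ μ) (ℓ₂ := spt₁ μ) (e := e)
      (fun x hx => by rw [h2]; exact epsS_le hx)
      (fun x hx hx2 => by rw [h1]; exact zetaS_le hx (by rw [hx2, h2]))
    intro x hx
    have hkx := key x hx
    rw [h1] at hkx ⊢
    have hex : epsS c J μ ≤ spt₂ μ x := epsS_le hx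
    rw [← h2] at hex
    have hsplit : ∀ t : ℕ, N * t = (zetaS c J μ + 1) * t + t := by intro t; rw [hN]; ring
    rw [hsplit, hsplit]
    omega
  have hℓ : 1 * spt₁ μ e + N * spt₂ μ e = zetaS c J μ + N * epsS c J μ := by rw [← h1, ← h2]; ring
  have hδζ := deltaS_le_zetaS_add_epsS hne
  have hNε : epsS c J μ ≤ N * epsS c J μ := Nat.le_mul_of_pos_left _ (by omega)
  have hLℓ : μ.factorial < 1 * spt₁ μ e + N * spt₂ μ e := by rw [hℓ]; omega
  obtain ⟨f, hf, hinit⟩ := exists_isInitialTerm_levelWeight_of_isMinOn c hgen hdim Nat.one_pos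
    (by omega) he hmin (by omega)
  set w₀' := 1 * spt₁ μ e + N * spt₂ μ e - μ.factorial * 1 with hw₀'
  have hwt : levelWeight μ (1 * spt₁ μ e + N * spt₂ μ e) 1 N =
      curvePullbackWeight (levelWeight μ w₀' 1 N) := by
    rw [← levelWeight_eq_curvePullbackWeight, Nat.sub_add_cancel (by omega)]
  rw [hwt] at hinit
  have hW' : ∀ i, 0 < levelWeight μ w₀' 1 N i := levelWeight_pos (by omega) Nat.one_pos (by omega)
  refine ⟨curvePt μ e, curvePt_mem_pts φ h₁ h₀ h₂ _ hgen hdim hgen' hdim' hW' hJμ hf he.2 hinit,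
    ?_, ?_⟩
  · rw [spt₂_curvePt, h2]
  · have hαζ := alphaS_le_zetaS hne
    have hdeg : μ ≤ e 0 + e 1 := by
      have h3 : (μ - e 0) * sfac μ e ≤ e 1 * sfac μ e := by
        rw [sub_mul_sfac he.2]
        have : μ.factorial ≤ spt₁ μ e := by rw [h1]; omega
        rwa [spt₁] at this
      have := Nat.le_of_mul_le_mul_right h3 (sfac_pos he.2)
      omega
    have := spt₁_curvePt_add he.2 hdeg
    omega

include h₁ h₀ h₂ hgen hdim hgen' hdim' in
/-- Lower bound `ε′ ≥ ε` (curve chart; `εs > 0`). [cite: CossartJannsenSaito2020, Lemma 12.4 (4)] -/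
theorem epsS_le_spt₂_colon_curve (hα : μ.factorial ≤ alphaS c J μ) {e' : Fin 3 →₀ ℕ}
    (he' : e' ∈ pts c' J' μ) :
    epsS c J μ ≤ spt₂ μ e' := by
  rcases Nat.eq_zero_or_pos (epsS c J μ) with h0 | hε
  · rw [h0]; exact Nat.zero_le _
  by_contra hlt
  push Not at hlt
  set N := spt₁ μ e' + 1 with hN
  have h := forall_pts_colon_curve_of_forall_pts φ h₁ h₀ h₂ hgen hdim hgen' hdim'
    (w₀' := N * epsS c J μ + (alphaS c J μ - μ.factorial)) (p₁' := 1) (p₂' := N)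
    (by have : 1 * 1 ≤ N * epsS c J μ := Nat.mul_le_mul (by omega) hε
        omega) Nat.one_pos (by omega) (fun e he => by
      have ha := alphaS_le he
      have h2 := epsS_le he
      have h3 : N * epsS c J μ ≤ N * spt₂ μ e := Nat.mul_le_mul_left _ h2
      omega) e' he'
  have h3 : N * (spt₂ μ e' + 1) ≤ N * epsS c J μ := Nat.mul_le_mul_left _ hlt
  rw [Nat.mul_add, mul_one] at h3
  omega

include h₁ h₀ h₂ hgen hdim hgen' hdim' in
/-- **`ε′ = ε`** (curve chart). [cite: CossartJannsenSaito2020, Lemma 12.4 (4)] -/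
theorem epsS_colon_curve_eq (hJμ : J ≤ Ideal.span {c 0, c 1} ^ μ)
    (hne : (pts c J μ).Nonempty) (hδ : μ.factorial < deltaS c J μ)
    (hα : μ.factorial ≤ alphaS c J μ) : epsS c' J' μ = epsS c J μ := by
  obtain ⟨e', he', h2, -⟩ := exists_pts_colon_curve_zeta φ h₁ h₀ h₂ hgen hdim hgen' hdim' hJμ hne hδ hα
  have hne' : (pts c' J' μ).Nonempty := ⟨e', he'⟩
  refine le_antisymm ?_ ?_
  · rw [← h2]; exact epsS_le he'
  · obtain ⟨b, hb, hb2⟩ := exists_pts_epsS hne'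
    rw [← hb2]
    exact epsS_le_spt₂_colon_curve φ h₁ h₀ h₂ hgen hdim hgen' hdim' hα hb

include h₁ h₀ h₂ hgen hdim hgen' hdim' in
/-- **`ζ′ ≤ ζ − 1`** (curve chart; scaled: `ζs′ + L ≤ ζs`). [cite: CossartJannsenSaito2020, Lemma 12.4 (4)] -/
theorem zetaS_colon_curve_add_le (hJμ : J ≤ Ideal.span {c 0, c 1} ^ μ)
    (hne : (pts c J μ).Nonempty) (hδ : μ.factorial < deltaS c J μ)
    (hα : μ.factorial ≤ alphaS c J μ) : zetaS c' J' μ + μ.factorial ≤ zetaS c J μ := by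
  obtain ⟨e', he', h2, h1⟩ := exists_pts_colon_curve_zeta φ h₁ h₀ h₂ hgen hdim hgen' hdim' hJμ hne hδ hα
  have hε := epsS_colon_curve_eq φ h₁ h₀ h₂ hgen hdim hgen' hdim' hJμ hne hδ hα
  have := zetaS_le he' (by rw [h2, hε])
  omega

end Laws

end Literature.AlgebraicGeometry.Resolution
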